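import Summits.SmoothPoincare4.SmoothPoincare4.Theorems.AcyclicBisectionExists.Negative.Witness
import Literature.Topology.FourManifolds.BoundaryGluingRelHomology
import Literature.Topology.FourManifolds.RelFundamentalClassOfOrientation
import Literature.AlgebraicTopology.SingularHomology.RelFundamentalClassModTwo
import Literature.AlgebraicTopology.SingularHomology.UniversalCoefficientsField
import Literature.Geometry.Symplectic.SteinOrientation

/-!
# `AcyclicBisectionExists` — negative-side support (2/5): every witness is a tree
# `BoundaryGluingData`; Lefschetz duality on the Stein half; homological bookkeeping

* §5 `Witness.gluingData` — every witness is a tree `BoundaryGluingData` (`NullCobordism`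
  halves, boundary bijection `seamEquiv`): gluing uniqueness and relative-homology isos apply.
* §6 `isIso_relMap₂` (`Hₖ(W₂, ∂W₂; G) ≅ Hₖ(M, e₁W₁; G)`), `exists_lefschetz₂` (the Stein half is
  ℚ-oriented; Lefschetz duality `Hᵖ(W₂; ℚ) ≅ H_q(W₂, ∂W₂; ℚ)`), `isZero_relHomology₂`,
  `isZero_homology_of_acyclic` (ANY `M` carrying an acyclic witness has `H₁ = H₂ = H₃ = 0` over
  ℚ), `isZero_homology_bd₂/bd₁` (seam a ℚHS in degrees 1, 2), and the `swap` symmetry.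
-/

noncomputable section

-- the prescribed namespace `Summit.<P>.<Sub>.…` duplicates `SmoothPoincare4` (P = Sub)
set_option linter.dupNamespace false

open scoped Manifold ContDiff Topology ContinuousMap
open Set Function CategoryTheory CategoryTheory.Limits
open Literature.Geometry.Symplectic Literature.AlgebraicTopology.SingularHomology

namespace Summit.SmoothPoincare4.SmoothPoincare4.Theorems.AcyclicBisectionExists.Negative

open Summit.SmoothPoincare4.SmoothPoincare4.Theses.ConvexBisection

/-- Local notation: the model space `ℝ⁴`. -/
local notation "𝔼4" => EuclideanSpace ℝ (Fin 4)
/-- Local notation: the round 4-sphere. -/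
local notation "𝕊⁴" => (Metric.sphere (0 : EuclideanSpace ℝ (Fin 5)) 1)

/-! ## §5 Every witness is a boundary gluing (tree `BoundaryGluingData`) -/

namespace Witness

open Literature.Topology.FourManifolds

variable {M : Type} [TopologicalSpace M] [ChartedSpace 𝔼4 M] (B : Witness M)

/-- The boundary `∂W₁` of the first half, as a type. [folklore] -/
abbrev Bd₁ (B : Witness M) : Type := ↥((𝓡∂ 4).boundary B.W₁)

/-- The boundary `∂W₂` of the second half, as a type. [folklore] -/
abbrev Bd₂ (B : Witness M) : Type := ↥((𝓡∂ 4).boundary B.W₂)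

/-! Bridging instances: the tree's boundary/gluing library is written at dimension `n + 1`;
instance search does not see the literal `4` as `3 + 1`, so we re-export the structure of the
halves at `3 + 1` and register the boundary manifolds (`BoundaryManifold.chartedSpace/isManifold`,
Lee Thm 5.11) explicitly. -/

/-- The atlas of `W₁`, re-keyed at `3 + 1`. [folklore] -/
instance chart₁' : ChartedSpace (EuclideanHalfSpace (3 + 1)) B.W₁ := B.chart₁
/-- The atlas of `W₂`, re-keyed at `3 + 1`. [folklore] -/
instance chart₂' : ChartedSpace (EuclideanHalfSpace (3 + 1)) B.W₂ := B.chart₂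
/-- The smooth structure of `W₁`, re-keyed at `3 + 1`. [folklore] -/
instance mfd₁' : IsManifold (𝓡∂ (3 + 1)) ∞ B.W₁ := B.mfd₁
/-- The smooth structure of `W₂`, re-keyed at `3 + 1`. [folklore] -/
instance mfd₂' : IsManifold (𝓡∂ (3 + 1)) ∞ B.W₂ := B.mfd₂
/-- The boundary manifold `∂W₁` (restricted charts, Lee Thm 5.11). [folklore] -/
instance chartedSpace_bd₁ : ChartedSpace (EuclideanSpace ℝ (Fin 3)) B.Bd₁ :=
  BoundaryManifold.chartedSpace 3 B.W₁
/-- The boundary manifold `∂W₂` (restricted charts, Lee Thm 5.11). [folklore] -/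
instance chartedSpace_bd₂ : ChartedSpace (EuclideanSpace ℝ (Fin 3)) B.Bd₂ :=
  BoundaryManifold.chartedSpace 3 B.W₂
/-- `∂W₁` is a smooth 3-manifold. [folklore] -/
instance isManifold_bd₁ : IsManifold (𝓡 3) ∞ B.Bd₁ := BoundaryManifold.isManifold 3 B.W₁
/-- `∂W₂` is a smooth 3-manifold. [folklore] -/
instance isManifold_bd₂ : IsManifold (𝓡 3) ∞ B.Bd₂ := BoundaryManifold.isManifold 3 B.W₂

/-- `∂W₁` is compact (closed in the compact `W₁`). [folklore] -/
instance compactSpace_bd₁ : CompactSpace B.Bd₁ :=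
  isCompact_iff_compactSpace.mp
    (ModelWithCorners.isClosed_boundary (I := 𝓡∂ 4) (M := B.W₁) (n := ∞) (by simp)).isCompact

/-- `∂W₂` is compact (closed in the compact `W₂`). [folklore] -/
instance compactSpace_bd₂ : CompactSpace B.Bd₂ :=
  isCompact_iff_compactSpace.mp
    (ModelWithCorners.isClosed_boundary (I := 𝓡∂ 4) (M := B.W₂) (n := ∞) (by simp)).isCompact

/-- For `z ∈ ∂W₁` the seam point `e₁ z` is hit by a unique boundary point of `W₂`. [folklore] -/
theorem exists_e₂_eq (z : B.Bd₁) : ∃ w : B.W₂, w ∈ (𝓡∂ 4).boundary B.W₂ ∧ B.e₂ w = B.e₁ z := by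
  have hz : B.e₁ z ∈ B.seam := by rw [seam_eq_image₁]; exact mem_image_of_mem _ z.2
  obtain ⟨-, ⟨w, hw⟩⟩ := hz
  exact ⟨w, B.mem_boundary₂_of_mem_range w ⟨z, hw.symm⟩, hw⟩

/-- For `z ∈ ∂W₂` the seam point `e₂ z` is hit by a unique boundary point of `W₁`. [folklore] -/
theorem exists_e₁_eq (z : B.Bd₂) : ∃ w : B.W₁, w ∈ (𝓡∂ 4).boundary B.W₁ ∧ B.e₁ w = B.e₂ z := by
  have hz : B.e₂ z ∈ B.seam := by rw [seam_eq_image₂]; exact mem_image_of_mem _ z.2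
  obtain ⟨⟨w, hw⟩, -⟩ := hz
  exact ⟨w, B.mem_boundary₁_of_mem_range w ⟨z, hw.symm⟩, hw⟩

/-- The identification of the boundaries `∂W₁ → ∂W₂` through the seam: `e₂ (seamMap z) = e₁ z`.
[folklore] -/
def seamMap (z : B.Bd₁) : B.Bd₂ :=
  ⟨Classical.choose (B.exists_e₂_eq z), (Classical.choose_spec (B.exists_e₂_eq z)).1⟩

/-- `e₂ (seamMap z) = e₁ z`. [folklore] -/
theorem e₂_seamMap (z : B.Bd₁) : B.e₂ (B.seamMap z) = B.e₁ z :=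
  (Classical.choose_spec (B.exists_e₂_eq z)).2

/-- The inverse identification `∂W₂ → ∂W₁`. [folklore] -/
def seamMap' (z : B.Bd₂) : B.Bd₁ :=
  ⟨Classical.choose (B.exists_e₁_eq z), (Classical.choose_spec (B.exists_e₁_eq z)).1⟩

/-- `e₁ (seamMap' z) = e₂ z`. [folklore] -/
theorem e₁_seamMap' (z : B.Bd₂) : B.e₁ (B.seamMap' z) = B.e₂ z :=
  (Classical.choose_spec (B.exists_e₁_eq z)).2

/-- **The gluing bijection `φ : ∂W₁ ≃ ∂W₂`** of a witness (`e₂ ∘ φ = e₁` on `∂W₁`). [folklore] -/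
def seamEquiv : B.Bd₁ ≃ B.Bd₂ where
  toFun := B.seamMap
  invFun := B.seamMap'
  left_inv z := Subtype.ext (B.injective_e₁ (by rw [e₁_seamMap', e₂_seamMap]))
  right_inv z := Subtype.ext (B.injective_e₂ (by rw [e₂_seamMap, e₁_seamMap']))

/-- `e₂ ∘ seamEquiv = e₁` on `∂W₁`. [folklore] -/
@[simp] theorem e₂_seamEquiv (z : B.Bd₁) : B.e₂ (B.seamEquiv z) = B.e₁ z := B.e₂_seamMap z

variable [T2Space M] [SecondCountableTopology M]

/-- The first half as a null-cobordism of its boundary (tree `NullCobordism`; the boundary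
carries the restricted-chart smooth structure `BoundaryManifold.boundaryData`, Lee Thm 5.11).
Reducible, so that instance search sees through `B.nullCobordism₁.W = B.W₁`. [folklore] -/
@[reducible] def nullCobordism₁ : NullCobordism 3 B.Bd₁ :=
  haveI := B.t2Space₁
  haveI := B.secondCountableTopology₁
  { W := B.W₁
    incl := Subtype.val
    isSmoothEmbedding_incl := BoundaryManifold.isSmoothEmbedding_subtype_val
    range_incl := Subtype.range_val }

/-- The second half as a null-cobordism of its boundary. [folklore] -/
@[reducible] def nullCobordism₂ : NullCobordism 3 B.Bd₂ :=
  haveI := B.t2Space₂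
  haveI := B.secondCountableTopology₂
  { W := B.W₂
    incl := Subtype.val
    isSmoothEmbedding_incl := BoundaryManifold.isSmoothEmbedding_subtype_val
    range_incl := Subtype.range_val }

/-- The total space of `nullCobordism₁` is `W₁`. [folklore] -/
@[simp] theorem nullCobordism₁_W : B.nullCobordism₁.W = B.W₁ := rfl
/-- The total space of `nullCobordism₂` is `W₂`. [folklore] -/
@[simp] theorem nullCobordism₂_W : B.nullCobordism₂.W = B.W₂ := rfl

/-- **Every witness of the crux is a boundary gluing `M = W₁ ∪_φ W₂` in the sense of the tree**
(`Literature.Topology.FourManifolds.BoundaryGluingData`, Hirsch Ch. 8 §2): the two smooth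
embeddings cover `M` and meet exactly along `∂W₁ ≡_φ ∂W₂`.  Consequences available to provers at
once: gluing UNIQUENESS (`nonempty_diffeomorph_of_isBoundaryGluing`: `M` is determined up to
diffeomorphism by `(W₁, W₂, φ)` — the rigidity crux is a statement about the triple), the flat
seam charts, `T2`/compactness of `M` from the pieces, and the relative-homology identifications
`Hₖ(W₂, ∂W₂) ≅ Hₖ(M, e₁ W₁)` used in §6. [folklore] -/
def gluingData : BoundaryGluingData B.nullCobordism₁.boundaryData B.nullCobordism₂.boundaryData
    B.seamEquiv M where
  jA := B.e₁
  jB := B.e₂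
  isSmoothEmbedding_jA := B.emb₁
  isSmoothEmbedding_jB := B.emb₂
  range_union := B.cover
  jA_eq_jB_iff a b := by
    constructor
    · intro h
      have ha := (B.mem_boundary_of_eq h).1
      refine ⟨⟨a, ha⟩, rfl, ?_⟩
      apply B.injective_e₂
      change B.e₂ b = B.e₂ (B.seamEquiv ⟨a, ha⟩)
      rw [e₂_seamEquiv, ← h]
    · rintro ⟨z, rfl, rfl⟩
      exact (B.e₂_seamEquiv z).symm

/-- The first embedding of the gluing datum is `e₁`. [folklore] -/
@[simp] theorem gluingData_jA : B.gluingData.jA = B.e₁ := rfl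
/-- The second embedding of the gluing datum is `e₂`. [folklore] -/
@[simp] theorem gluingData_jB : B.gluingData.jB = B.e₂ := rfl

end Witness

/-! ## §6 Homological bookkeeping of a witness: `Hₖ(W₂, ∂W₂) ≅ Hₖ(M, e₁ W₁)`, Lefschetz
duality on the Stein half, and `H₁ = H₂ = H₃ = 0` (over ℚ) for every `M` carrying an acyclic
witness -/

namespace Witness

open Literature.Topology.FourManifolds

variable {M : Type} [TopologicalSpace M] [ChartedSpace 𝔼4 M] (B : Witness M)

/-! More bridging instances, at the forms `2 + 1 + 1` / `2 + 1` produced by the tree's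
`m + 1 + 1`-indexed statements (`BoundaryGluingRelHomology`, `RelFundamentalClassOfOrientation`). -/
/-- The atlas of `W₁`, re-keyed at `2 + 1 + 1`. [folklore] -/
instance chart₁'' : ChartedSpace (EuclideanHalfSpace (2 + 1 + 1)) B.W₁ := B.chart₁
/-- The atlas of `W₂`, re-keyed at `2 + 1 + 1`. [folklore] -/
instance chart₂'' : ChartedSpace (EuclideanHalfSpace (2 + 1 + 1)) B.W₂ := B.chart₂
/-- The smooth structure of `W₁`, re-keyed at `2 + 1 + 1`. [folklore] -/
instance mfd₁'' : IsManifold (𝓡∂ (2 + 1 + 1)) ∞ B.W₁ := B.mfd₁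
/-- The smooth structure of `W₂`, re-keyed at `2 + 1 + 1`. [folklore] -/
instance mfd₂'' : IsManifold (𝓡∂ (2 + 1 + 1)) ∞ B.W₂ := B.mfd₂
/-- The boundary manifold `∂W₁`, re-keyed at `2 + 1`. [folklore] -/
instance chartedSpace_bd₁' : ChartedSpace (EuclideanSpace ℝ (Fin (2 + 1))) B.Bd₁ :=
  BoundaryManifold.chartedSpace 3 B.W₁
/-- The boundary manifold `∂W₂`, re-keyed at `2 + 1`. [folklore] -/
instance chartedSpace_bd₂' : ChartedSpace (EuclideanSpace ℝ (Fin (2 + 1))) B.Bd₂ :=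
  BoundaryManifold.chartedSpace 3 B.W₂
/-- `∂W₁` is smooth, re-keyed at `2 + 1`. [folklore] -/
instance isManifold_bd₁' : IsManifold (𝓡 (2 + 1)) ∞ B.Bd₁ := BoundaryManifold.isManifold 3 B.W₁
/-- `∂W₂` is smooth, re-keyed at `2 + 1`. [folklore] -/
instance isManifold_bd₂' : IsManifold (𝓡 (2 + 1)) ∞ B.Bd₂ := BoundaryManifold.isManifold 3 B.W₂

/-- `∂W₂` is Hausdorff when `M` is. [folklore] -/
instance t2Space_bd₂ [T2Space M] : T2Space B.Bd₂ := by
  haveI := B.t2Space₂; infer_instance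

/-- `∂W₂ ≠ ∅` over a nonempty `M`. [folklore] -/
theorem nonempty_bd₂ [Nonempty M] : Nonempty B.Bd₂ :=
  let ⟨w, hw⟩ := B.boundaries_nonempty.2; ⟨⟨w, hw⟩⟩

/-- `e₂` as a continuous map. [folklore] -/
def e₂CM : C(B.W₂, M) := ⟨B.e₂, B.continuous_e₂⟩

/-- `e₂` maps `∂W₂` into `e₁ W₁` (a map of pairs `(W₂, ∂W₂) → (M, e₁W₁)`). [folklore] -/
theorem mapsTo_e₂_boundary : MapsTo B.e₂ ((𝓡∂ 4).boundary B.W₂) (range B.e₁) := by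
  intro w hw
  have : B.e₂ w ∈ B.seam := by rw [seam_eq_image₂]; exact mem_image_of_mem _ hw
  exact this.1

/-- In an acyclic witness, `Hₖ(e₁ W₁; ℚ) = 0` for `k > 0` (`e₁` is a homeomorphism onto its
image). [folklore] -/
theorem isZero_homology_range_e₁ (hB : B.Acyclic) {k : ℕ} (hk : 0 < k) :
    IsZero (singularHomology ℚ ℚ ↥(range B.e₁) k) :=
  (hB k hk).1.of_iso (singularHomology.mapIso ℚ ℚ B.emb₁.isEmbedding.toHomeomorph k).symm

/-- In an acyclic witness, `j_* : Hₖ(M) → Hₖ(M, e₁ W₁)` is injective for `k > 0`. [folklore] -/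
theorem mono_ofAbsolute (hB : B.Acyclic) {k : ℕ} (hk : 0 < k) :
    Mono (relativeSingularHomology.ofAbsolute ℚ ℚ M (range B.e₁) k) :=
  (relativeSingularHomology.exact_map_ofAbsolute ℚ ℚ (range B.e₁) k).mono_g
    ((B.isZero_homology_range_e₁ hB hk).eq_of_src _ _)

/-- In an acyclic witness, `j_* : Hₖ₊₁(M) → Hₖ₊₁(M, e₁ W₁)` is surjective for `k > 0`. [folklore] -/
theorem epi_ofAbsolute (hB : B.Acyclic) {k : ℕ} (hk : 0 < k) :
    Epi (relativeSingularHomology.ofAbsolute ℚ ℚ M (range B.e₁) (k + 1)) :=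
  (relativeSingularHomology.exact_ofAbsolute_δ ℚ ℚ (range B.e₁) k).epi_f
    ((B.isZero_homology_range_e₁ hB hk).eq_of_tgt _ _)

variable [T2Space M] [SecondCountableTopology M]

/-- **`(e₂)_* : Hₖ(W₂, ∂W₂; G) ≅ Hₖ(M, e₁ W₁; G)`** for every witness over a nonempty `M` and
all coefficients (excision + collar slide; the tree's
`BoundaryGluingData.isIso_map_jB_boundary'`, Hatcher Thm 2.20 / Prop 2.22). [folklore] -/
theorem isIso_relMap₂ [IsManifold (𝓡 4) ∞ M] [Nonempty M] (R : Type) [CommRing R] (Gr : Type)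
    [AddCommGroup Gr] [Module R Gr] (k : ℕ) :
    IsIso (relativeSingularHomology.map R Gr B.e₂CM B.mapsTo_e₂_boundary k) := by
  haveI := B.nonempty_bd₂
  exact B.gluingData.isIso_map_jB_boundary' R Gr k

/-- **The Stein half `W₂` carries a relative fundamental class over ℚ.**  The Stein structure
orients `W₂` (`SteinStructure.complexOrientation`), whence an integral relative fundamental class
(`NullCobordism.exists_isRelFundamentalClass_of_smoothOrientation`), an orientation of the
external collar (`ExtCollar.orientation`), its ℚ-version (`HomologicalOrientation.toCoeff`) and a
ℚ relative fundamental class (`ExtCollar.exists_isRelFundamentalClass_of_orientation`).  All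
inputs are PROVED tree theorems. [folklore] -/
theorem exists_isRelFundamentalClass_rat₂ [Nonempty M] :
    ∃ zq : relativeSingularHomology ℚ ℚ B.W₂ ((𝓡∂ (2 + 1 + 1)).boundary B.W₂) (2 + 1 + 1),
      IsRelFundamentalClass ℚ ((𝓡∂ (2 + 1 + 1)).boundary B.W₂) zq := by
  haveI := B.t2Space₂
  haveI := B.nonempty_bd₂
  obtain ⟨z, hz⟩ :=
    B.nullCobordism₂.exists_isRelFundamentalClass_of_smoothOrientation B.J₂.complexOrientation
  exact ExtCollar.exists_isRelFundamentalClass_of_orientation (R := ℚ) (2 + 1)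
    ((ExtCollar.orientation z hz).toCoeff ℚ)

/-- **Lefschetz duality on the Stein half**: `a ↦ a ⌢ [W₂, ∂W₂]` is a bijection
`Hᵖ(W₂; ℚ) → H_q(W₂, ∂W₂; ℚ)` for `p + q = 4` (tree
`bijective_relCapProduct_of_isRelFundamentalClass_holds`, Spanier 6.3.12 / Hatcher 3.43).
[folklore] -/
theorem exists_lefschetz₂ [Nonempty M] {p q : ℕ} (h : p + q = 2 + 1 + 1) :
    ∃ zq : relativeSingularHomology ℚ ℚ B.W₂ ((𝓡∂ (2 + 1 + 1)).boundary B.W₂) (2 + 1 + 1),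
      Function.Bijective fun a : singularCohomology ℚ ℚ B.W₂ p =>
        relCapProduct (M := ℚ) ((𝓡∂ (2 + 1 + 1)).boundary B.W₂) h a zq := by
  haveI := B.t2Space₂
  obtain ⟨zq, hzq⟩ := B.exists_isRelFundamentalClass_rat₂
  exact ⟨zq, bijective_relCapProduct_of_isRelFundamentalClass_holds (R := ℚ) (2 + 1) B.W₂ zq hzq h⟩

/-- **Lefschetz vanishing on the Stein half.**  If `W₂` is ℚ-acyclic in positive degrees then
`H_q(W₂, ∂W₂; ℚ) = 0` whenever `p + q = 4` with `0 < p`: Lefschetz duality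
`Hᵖ(W₂; ℚ) ≅ H_q(W₂, ∂W₂; ℚ)` (`exists_lefschetz₂`) and `Hᵖ(W₂; ℚ) = 0` by the field universal
coefficient theorem (`kroneckerPairing_injective_of_field`) from `Hₚ(W₂; ℚ) = 0`. [folklore] -/
theorem isZero_relHomology₂ [Nonempty M] (hB : B.AcyclicRight) {p q : ℕ} (hp : 0 < p)
    (h : p + q = 2 + 1 + 1) :
    IsZero (relativeSingularHomology ℚ ℚ B.W₂ ((𝓡∂ (2 + 1 + 1)).boundary B.W₂) q) := by
  haveI := B.t2Space₂
  -- (1)–(3) Lefschetz duality over ℚ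
  obtain ⟨zq, hbij⟩ := B.exists_lefschetz₂ h
  -- (4) `Hᵖ(W₂; ℚ)` is trivial
  haveI : Subsingleton (singularHomology ℚ ℚ B.W₂ p) := ModuleCat.subsingleton_of_isZero (hB p hp)
  have hsub : Subsingleton (singularCohomology ℚ ℚ B.W₂ p) :=
    ⟨fun a b => kroneckerPairing_injective_of_field ℚ B.W₂ p
      (LinearMap.ext fun c => by rw [Subsingleton.elim c 0, map_zero, map_zero])⟩
  -- (5) so is the target of the duality bijection
  haveI : Subsingleton (relativeSingularHomology ℚ ℚ B.W₂ ((𝓡∂ (2 + 1 + 1)).boundary B.W₂) q) :=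
    ⟨fun x y => by
      obtain ⟨a, rfl⟩ := hbij.2 x
      obtain ⟨b, rfl⟩ := hbij.2 y
      rw [Subsingleton.elim a b]⟩
  exact ModuleCat.isZero_of_subsingleton _

/-- **Any `M` carrying an acyclic witness is a ℚ-homology sphere in degrees `1, 2, 3`**:
`Hₖ(M; ℚ) ↪ Hₖ(M, e₁ W₁; ℚ) ≅ Hₖ(W₂, ∂W₂; ℚ) = 0`.  This is exactly how the hypothesis
`M ≃ₕ S⁴` is USED by the statement: it cannot be weakened to "closed simply connected"
(§7, `ℂℙ²`). [folklore] -/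
theorem isZero_homology_of_acyclic [IsManifold (𝓡 4) ∞ M] [Nonempty M] (hB : B.Acyclic) {k : ℕ}
    (hk : 0 < k) (hk3 : k ≤ 3) : IsZero (singularHomology ℚ ℚ M k) := by
  haveI := B.mono_ofAbsolute hB hk
  haveI := B.isIso_relMap₂ ℚ ℚ k
  have hrel : IsZero (relativeSingularHomology ℚ ℚ M (range B.e₁) k) :=
    (B.isZero_relHomology₂ hB.right (p := 4 - k) (q := k) (by omega) (by omega)).of_iso
      (asIso (relativeSingularHomology.map ℚ ℚ B.e₂CM B.mapsTo_e₂_boundary k)).symm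
  exact IsZero.of_mono (relativeSingularHomology.ofAbsolute ℚ ℚ M (range B.e₁) k) hrel

/-- **The seam of an acyclic witness is a ℚ-homology sphere in degrees 1 and 2** — over ANY
nonempty `M` (no homotopy-sphere hypothesis): `H₁(∂W₂; ℚ) = H₂(∂W₂; ℚ) = 0`, from the exact
`Hₖ₊₁(W₂, ∂W₂) → Hₖ(∂W₂) → Hₖ(W₂)` with both ends zero (`isZero_relHomology₂`, acyclicity).  This
is the proved half of the informal gloss "(⇔ seam a connected ℚHS³)" in the crux text. [folklore] -/
theorem isZero_homology_bd₂ [Nonempty M] (hB : B.AcyclicRight) {k : ℕ} (hk : 0 < k) (hk2 : k ≤ 2) :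
    IsZero (singularHomology ℚ ℚ B.Bd₂ k) := by
  have hrel := B.isZero_relHomology₂ hB (p := 3 - k) (q := k + 1) (by omega) (by omega)
  exact (relativeSingularHomology.exact_δ_map ℚ ℚ ((𝓡∂ 4).boundary B.W₂) k).isZero_of_both_zeros
    (hrel.eq_of_src _ _) ((hB k hk).eq_of_tgt _ _)

end Witness

/-! ### Swapping the halves: every `₂`-statement above holds for `W₁` as well -/

namespace Witness

variable {M : Type} [TopologicalSpace M] [ChartedSpace 𝔼4 M]

/-- **Swap the two halves of a witness.** The crux's conditions are symmetric in `(W₁, W₂)`.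
[folklore] -/
def swap (B : Witness M) : Witness M where
  W₁ := B.W₂
  W₂ := B.W₁
  J₁ := B.J₂
  J₂ := B.J₁
  e₁ := B.e₂
  e₂ := B.e₁
  emb₁ := B.emb₂
  emb₂ := B.emb₁
  cover := by rw [union_comm]; exact B.cover
  inter₁ := by rw [inter_comm]; exact B.inter₂
  inter₂ := by rw [inter_comm]; exact B.inter₁
  contact w₂ w₁ h := (B.contact w₁ w₂ h.symm).symm

/-- The first half of the swapped witness is `W₂`. [folklore] -/
@[simp] theorem swap_W₁ (B : Witness M) : B.swap.W₁ = B.W₂ := rfl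
/-- The second half of the swapped witness is `W₁`. [folklore] -/
@[simp] theorem swap_W₂ (B : Witness M) : B.swap.W₂ = B.W₁ := rfl
/-- The first embedding of the swapped witness is `e₂`. [folklore] -/
@[simp] theorem swap_e₁ (B : Witness M) : B.swap.e₁ = B.e₂ := rfl
/-- The second embedding of the swapped witness is `e₁`. [folklore] -/
@[simp] theorem swap_e₂ (B : Witness M) : B.swap.e₂ = B.e₁ := rfl

/-- Acyclicity is symmetric under swapping the halves. [folklore] -/
theorem Acyclic.swap {B : Witness M} (hB : B.Acyclic) : B.swap.Acyclic :=
  fun k hk => ⟨(hB k hk).2, (hB k hk).1⟩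

/-- Left acyclicity becomes right acyclicity of the swapped witness. [folklore] -/
theorem AcyclicLeft.swap {B : Witness M} (hB : B.AcyclicLeft) : B.swap.AcyclicRight := hB
/-- Right acyclicity becomes left acyclicity of the swapped witness. [folklore] -/
theorem AcyclicRight.swap {B : Witness M} (hB : B.AcyclicRight) : B.swap.AcyclicLeft := hB

/-- Connectedness of `W₂` seen as the first half of the swapped witness. [folklore] -/
instance connectedSpace_swap_W₁ (B : Witness M) [h : ConnectedSpace B.W₂] : ConnectedSpace B.swap.W₁ := h
/-- Connectedness of `W₁` seen as the second half of the swapped witness. [folklore] -/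
instance connectedSpace_swap_W₂ (B : Witness M) [h : ConnectedSpace B.W₁] : ConnectedSpace B.swap.W₂ := h

variable [T2Space M] [SecondCountableTopology M] (B : Witness M)

/-- Lefschetz vanishing on the FIRST half: `H_q(W₁, ∂W₁; ℚ) = 0` for `p + q = 4`, `0 < p`, in an
acyclic witness. [folklore] -/
theorem isZero_relHomology₁ [Nonempty M] (hB : B.AcyclicLeft) {p q : ℕ} (hp : 0 < p)
    (h : p + q = 2 + 1 + 1) :
    IsZero (relativeSingularHomology ℚ ℚ B.W₁ ((𝓡∂ (2 + 1 + 1)).boundary B.W₁) q) :=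
  B.swap.isZero_relHomology₂ hB.swap hp h

/-- `H₁(∂W₁; ℚ) = H₂(∂W₁; ℚ) = 0` as soon as the FIRST half is acyclic. [folklore] -/
theorem isZero_homology_bd₁ [Nonempty M] (hB : B.AcyclicLeft) {k : ℕ} (hk : 0 < k) (hk2 : k ≤ 2) :
    IsZero (singularHomology ℚ ℚ B.Bd₁ k) :=
  B.swap.isZero_homology_bd₂ hB.swap hk hk2

end Witness


end Summit.SmoothPoincare4.SmoothPoincare4.Theorems.AcyclicBisectionExists.Negative
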